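import Literature.RingTheory.CohomologyAnnihilator.TowerBasic
import Literature.AlgebraicGeometry.Resolution.PresentationExt
import HarnessLib

/-!
# Syzygy modules `Ωˢ M`: isomorphism invariance, direct sums, Schanuel, horseshoe

Topic: `Literature/RingTheory/CohomologyAnnihilator`. Folklore facts about the predicate
`IsSyzygy s M K` ("`K` is an `s`-th syzygy module of `M`", a chain of `s` short exact sequences
with finitely generated projective middle terms; `StrongGenerator.lean`) used without comment in
[IyengarTakahashi2014, §§2, 4, 5] ("syzygies are only defined up to projective summands"):

* invariance under isomorphisms of `K` and of `M` (`IsSyzygy.of_iso`, `IsSyzygy.of_iso_base`),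
  `Ω¹` unfolded (`isSyzygy_one_iff`), peeling a syzygy chain from the `M` end
  (`isSyzygy_succ_iff_exists_first`), composition (`IsSyzygy.trans`);
* direct sums (`IsSyzygy.prod`), free summands (`IsSyzygy.prod_projective`);
* **Schanuel's lemma** for `Ωˢ` (`IsSyzygy.exists_stablyIso`): two `s`-th syzygy modules of `M`
  are stably isomorphic, `K₁ ⊕ P₂ ≅ K₂ ⊕ P₁` with `Pᵢ` finitely generated projective
  (from `PresExt.schanuel`, Matsumura §19 Lemma 3);
* **the horseshoe lemma** (`exists_isSyzygy_of_shortExact`): for `0 → Y → Z → X → 0` exact and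
  `s`-th syzygies `K_Y`, `K_X` of `Y`, `X` there is an `s`-th syzygy `E` of `Z` and an exact
  `0 → K_Y → E → K_X → 0`;
* syzygies of a retract (`exists_retract_isSyzygy_of_retract`): if `X` is a retract of `Z` then
  any first syzygy of `X` is a retract of `Ω Z ⊕ Q`, `Q` finitely generated projective;
* finitely generated projectives lie in `add G` as soon as `A` does
  (`IsRetractOfPower.of_projective`).

## References

* S. B. Iyengar, R. Takahashi, *Annihilation of cohomology and strong generation of module
  categories*, IMRN 2016; arXiv:1404.1476 — §2 (Syzygy modules). [`IyengarTakahashi2014`]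
* H. Matsumura, *Commutative Ring Theory* (1987), §19 Lemma 3 (Schanuel). [`Matsumura1987`]
-/

noncomputable section

open CategoryTheory CategoryTheory.Limits

universe u

namespace Literature.RingTheory.CohomologyAnnihilator

variable {A : Type u} [CommRing A]

/-! ## More bridging lemmas -/

/-- Replacing the left object of a short exact sequence by an isomorphic one. [folklore] -/
theorem shortExact_iso_comp {Y Y' M X : ModuleCat.{u} A} {f : Y ⟶ M} {g : M ⟶ X} {w : f ≫ g = 0}
    (hS : (ShortComplex.mk f g w).ShortExact) (ε : Y ≅ Y') :
    ∃ w' : (ε.inv ≫ f) ≫ g = 0, (ShortComplex.mk (ε.inv ≫ f) g w').ShortExact := by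
  have w' : (ε.inv ≫ f) ≫ g = 0 := by rw [Category.assoc, w, comp_zero]
  exact ⟨w', ShortComplex.shortExact_of_iso (S₁ := ShortComplex.mk f g w)
    (ShortComplex.isoMk ε (Iso.refl _) (Iso.refl _) (by simp) (by simp)) hS⟩

/-- Replacing the right object of a short exact sequence by an isomorphic one. [folklore] -/
theorem shortExact_comp_iso₃ {Y M X X' : ModuleCat.{u} A} {f : Y ⟶ M} {g : M ⟶ X} {w : f ≫ g = 0}
    (hS : (ShortComplex.mk f g w).ShortExact) (ε : X ≅ X') :
    ∃ w' : f ≫ (g ≫ ε.hom) = 0, (ShortComplex.mk f (g ≫ ε.hom) w').ShortExact := by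
  have w' : f ≫ (g ≫ ε.hom) = 0 := by rw [← Category.assoc, w, zero_comp]
  exact ⟨w', ShortComplex.shortExact_of_iso (S₁ := ShortComplex.mk f g w)
    (ShortComplex.isoMk (Iso.refl _) (Iso.refl _) ε (by simp) (by simp)) hS⟩

/-- `Module.Projective` from categorical projectivity in `ModuleCat`. [folklore] -/
theorem moduleProjective_of_projective (P : ModuleCat.{u} A) (hP : Projective P) :
    Module.Projective A P :=
  (IsProjective.iff_projective (R := A) P).mpr hP

/-- The direct sum of two projective objects of `ModuleCat A` is projective. [folklore] -/
theorem projective_prod {P₁ P₂ : ModuleCat.{u} A} (h₁ : Projective P₁) (h₂ : Projective P₂) :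
    Projective (ModuleCat.of A (P₁ × P₂)) := by
  haveI := moduleProjective_of_projective P₁ h₁
  haveI := moduleProjective_of_projective P₂ h₂
  exact (IsProjective.iff_projective (R := A) (P₁ × P₂)).mp inferInstance

/-- A zero module is a (finitely generated) projective object. [folklore] -/
theorem projective_punit : Projective (ModuleCat.of A PUnit.{u + 1}) :=
  (IsProjective.iff_projective (R := A) PUnit.{u + 1}).mp inferInstance

/-! ## Isomorphism invariance, `Ω¹`, peeling -/

/-- `IsSyzygy s M K` is invariant under isomorphisms of `K`. [folklore] -/
theorem IsSyzygy.of_iso {M : ModuleCat.{u} A} :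
    ∀ {s : ℕ} {K K' : ModuleCat.{u} A}, IsSyzygy s M K → (K ≅ K') → IsSyzygy s M K'
  | 0, _, _, ⟨i⟩, e => ⟨e.symm ≪≫ i⟩
  | _ + 1, _, _, ⟨K'', P, h, hP, hproj, f, g, w, hS⟩, e => by
    obtain ⟨w', hS'⟩ := shortExact_iso_comp hS e
    exact ⟨K'', P, h, hP, hproj, e.inv ≫ f, g, w', hS'⟩

/-- `IsSyzygy s M K` is invariant under isomorphisms of `M`. [folklore] -/
theorem IsSyzygy.of_iso_base :
    ∀ {s : ℕ} {M M' K : ModuleCat.{u} A}, IsSyzygy s M K → (M ≅ M') → IsSyzygy s M' K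
  | 0, _, _, _, ⟨i⟩, e => ⟨i ≪≫ e⟩
  | _ + 1, _, _, _, ⟨K'', P, h, hP, hproj, f, g, w, hS⟩, e =>
    ⟨K'', P, h.of_iso_base e, hP, hproj, f, g, w, hS⟩

/-- `Ω¹ M` unfolded: `K` is a first syzygy of `M` iff there is an exact `0 → K → P → M → 0` with
`P` finitely generated projective. [cite: IyengarTakahashi2014, §2 (Syzygy modules)] -/
theorem isSyzygy_one_iff {M K : ModuleCat.{u} A} :
    IsSyzygy 1 M K ↔ ∃ P : ModuleCat.{u} A, Module.Finite A P ∧ Projective P ∧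
      ∃ (f : K ⟶ P) (g : P ⟶ M) (w : f ≫ g = 0), (ShortComplex.mk f g w).ShortExact := by
  constructor
  · rintro ⟨K', P, ⟨i⟩, hP, hproj, f, g, w, hS⟩
    obtain ⟨w', hS'⟩ := shortExact_comp_iso₃ hS i
    exact ⟨P, hP, hproj, f, g ≫ i.hom, w', hS'⟩
  · rintro ⟨P, hP, hproj, f, g, w, hS⟩
    exact ⟨M, P, ⟨Iso.refl M⟩, hP, hproj, f, g, w, hS⟩

/-- Peeling a syzygy chain from the `M` end: `K` is an `(s+1)`-th syzygy of `M` iff it is an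
`s`-th syzygy of a first syzygy of `M`. [folklore] -/
theorem isSyzygy_succ_iff_exists_first :
    ∀ {s : ℕ} {M K : ModuleCat.{u} A},
      IsSyzygy (s + 1) M K ↔ ∃ M' : ModuleCat.{u} A, IsSyzygy 1 M M' ∧ IsSyzygy s M' K
  | 0, M, K => by
    constructor
    · intro h
      exact ⟨K, h, ⟨Iso.refl K⟩⟩
    · rintro ⟨M', h, ⟨i⟩⟩
      exact h.of_iso i.symm
  | s + 1, M, K => by
    constructor
    · rintro ⟨K', P, h, hP, hproj, f, g, w, hS⟩
      obtain ⟨M', h1, hs⟩ := isSyzygy_succ_iff_exists_first.mp h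
      exact ⟨M', h1, K', P, hs, hP, hproj, f, g, w, hS⟩
    · rintro ⟨M', h1, K', P, hs, hP, hproj, f, g, w, hS⟩
      exact ⟨K', P, isSyzygy_succ_iff_exists_first.mpr ⟨M', h1, hs⟩, hP, hproj, f, g, w, hS⟩

/-- Composition of syzygy chains: an `s`-th syzygy of a `t`-th syzygy is an `(s+t)`-th syzygy.
[folklore] -/
theorem IsSyzygy.trans {M M' : ModuleCat.{u} A} {t : ℕ} (ht : IsSyzygy t M M') :
    ∀ {s : ℕ} {K : ModuleCat.{u} A}, IsSyzygy s M' K → IsSyzygy (s + t) M K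
  | 0, _, ⟨i⟩ => by
    rw [Nat.zero_add]
    exact ht.of_iso i.symm
  | s + 1, _, ⟨K', P, h, hP, hproj, f, g, w, hS⟩ => by
    rw [Nat.succ_add]
    exact ⟨K', P, ht.trans h, hP, hproj, f, g, w, hS⟩

/-! ## Zero modules, direct sums, projective summands -/

/-- A zero module is a first syzygy of a zero module. [folklore] -/
theorem isSyzygy_one_of_isZero {M K : ModuleCat.{u} A} (hM : IsZero M) (hK : IsZero K) :
    IsSyzygy 1 M K := by
  rw [isSyzygy_one_iff]
  refine ⟨K, ?_, ?_, 𝟙 K, 0, by simp, ?_⟩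
  · exact Module.Finite.of_surjective (0 : A →ₗ[A] K) fun x =>
      ⟨0, by rw [eq_zero_of_isZero hK x, map_zero]⟩
  · haveI : Subsingleton K := ⟨fun a b => by rw [eq_zero_of_isZero hK a, eq_zero_of_isZero hK b]⟩
    haveI : Module.Projective A K := Module.Projective.of_basis (Module.Basis.empty (ι := Fin 0) K)
    exact (IsProjective.iff_projective (R := A) K).mp inferInstance
  · exact ShortComplex.ShortExact.mk' ((ShortComplex.exact_iff_epi _ (by simp)).2
      (by simp only; infer_instance)) (by simp only; infer_instance) (hM.epi _)

/-- A finitely generated projective module is its own projective cover: `0` is a first syzygy of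
it. [folklore] -/
theorem isSyzygy_one_projective {P : ModuleCat.{u} A} (hP : Module.Finite A P) (hproj : Projective P) :
    IsSyzygy 1 P (ModuleCat.of A PUnit.{u + 1}) := by
  rw [isSyzygy_one_iff]
  obtain ⟨w, hS⟩ := exists_shortExact_of_linearMap (Y := ModuleCat.of A PUnit.{u + 1}) (M := P)
    (X := P) 0 LinearMap.id (fun a b _ => Subsingleton.elim a b) Function.surjective_id
    ((LinearMap.exact_zero_iff_injective _ LinearMap.id).mpr Function.injective_id)
  exact ⟨P, hP, hproj, _, _, w, hS⟩

/-- Direct sums of syzygy chains. [folklore] -/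
theorem IsSyzygy.prod :
    ∀ {s : ℕ} {M₁ K₁ M₂ K₂ : ModuleCat.{u} A}, IsSyzygy s M₁ K₁ → IsSyzygy s M₂ K₂ →
      IsSyzygy s (ModuleCat.of A (M₁ × M₂)) (ModuleCat.of A (K₁ × K₂))
  | 0, _, _, _, _, ⟨i₁⟩, ⟨i₂⟩ => ⟨(i₁.toLinearEquiv.prodCongr i₂.toLinearEquiv).toModuleIso⟩
  | s + 1, M₁, K₁, M₂, K₂, ⟨K₁', P₁, h₁, hP₁, hproj₁, f₁, g₁, w₁, hS₁⟩,
      ⟨K₂', P₂, h₂, hP₂, hproj₂, f₂, g₂, w₂, hS₂⟩ => by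
    obtain ⟨hf₁, hg₁, hfg₁⟩ := shortExact_unpack hS₁
    obtain ⟨hf₂, hg₂, hfg₂⟩ := shortExact_unpack hS₂
    haveI := hP₁
    haveI := hP₂
    obtain ⟨w, hS⟩ := exists_shortExact_of_linearMap (Y := ModuleCat.of A (K₁ × K₂))
      (M := ModuleCat.of A (P₁ × P₂)) (X := ModuleCat.of A (K₁' × K₂'))
      (f₁.hom.prodMap f₂.hom) (g₁.hom.prodMap g₂.hom) (hf₁.prodMap hf₂) (hg₁.prodMap hg₂)
      (exact_prodMap hfg₁ hfg₂)
    exact ⟨ModuleCat.of A (K₁' × K₂'), ModuleCat.of A (P₁ × P₂), h₁.prod h₂, inferInstance,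
      projective_prod hproj₁ hproj₂, _, _, w, hS⟩

/-- Adding a finitely generated projective summand to the base: a first syzygy of `M` is a first
syzygy of `M ⊕ Q`. [folklore] -/
theorem IsSyzygy.prod_projective {M K Q : ModuleCat.{u} A} (h : IsSyzygy 1 M K)
    (hQ : Module.Finite A Q) (hQproj : Projective Q) : IsSyzygy 1 (ModuleCat.of A (M × Q)) K :=
  (h.prod (isSyzygy_one_projective hQ hQproj)).of_iso
    (LinearEquiv.prodUnique (R := A) (M := K) (M₂ := PUnit.{u + 1})).toModuleIso

/-! ## Schanuel's lemma -/

/-- **Schanuel's lemma**, first syzygies: two first syzygy modules `K₁`, `K₂` of `M` are stably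
isomorphic, `K₁ ⊕ P₂ ≅ K₂ ⊕ P₁` for the respective (finitely generated projective) covers.
[cite: Matsumura1987, §19 Lemma 3] -/
theorem IsSyzygy.exists_stablyIso_one {M K₁ K₂ : ModuleCat.{u} A} (h₁ : IsSyzygy 1 M K₁)
    (h₂ : IsSyzygy 1 M K₂) : ∃ P₁ P₂ : ModuleCat.{u} A, Module.Finite A P₁ ∧ Projective P₁ ∧
      Module.Finite A P₂ ∧ Projective P₂ ∧
        Nonempty (ModuleCat.of A (K₁ × P₂) ≅ ModuleCat.of A (K₂ × P₁)) := by
  obtain ⟨P₁, hP₁, hproj₁, f₁, g₁, w₁, hS₁⟩ := isSyzygy_one_iff.mp h₁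
  obtain ⟨P₂, hP₂, hproj₂, f₂, g₂, w₂, hS₂⟩ := isSyzygy_one_iff.mp h₂
  obtain ⟨hf₁, hg₁, hfg₁⟩ := shortExact_unpack hS₁
  obtain ⟨hf₂, hg₂, hfg₂⟩ := shortExact_unpack hS₂
  haveI := moduleProjective_of_projective P₁ hproj₁
  haveI := moduleProjective_of_projective P₂ hproj₂
  obtain ⟨e⟩ := Literature.AlgebraicGeometry.Resolution.PresExt.schanuel f₁.hom g₁.hom f₂.hom
    g₂.hom hf₁ hfg₁.linearMap_ker_eq.symm hg₁ hf₂ hfg₂.linearMap_ker_eq.symm hg₂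
    (LinearEquiv.refl A M)
  exact ⟨P₁, P₂, hP₁, hproj₁, hP₂, hproj₂, ⟨e.toModuleIso⟩⟩

/-- **Schanuel's lemma for `Ωˢ`**: two `s`-th syzygy modules of `M` are stably isomorphic,
`K₁ ⊕ P₂ ≅ K₂ ⊕ P₁` with `P₁`, `P₂` finitely generated projective ("syzygies are well defined up
to projective summands"). [cite: Matsumura1987, §19 Lemma 3; IyengarTakahashi2014, §2] -/
theorem IsSyzygy.exists_stablyIso {M : ModuleCat.{u} A} :
    ∀ {s : ℕ} {K₁ K₂ : ModuleCat.{u} A}, IsSyzygy s M K₁ → IsSyzygy s M K₂ →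
      ∃ P₁ P₂ : ModuleCat.{u} A, Module.Finite A P₁ ∧ Projective P₁ ∧
        Module.Finite A P₂ ∧ Projective P₂ ∧
          Nonempty (ModuleCat.of A (K₁ × P₂) ≅ ModuleCat.of A (K₂ × P₁))
  | 0, K₁, K₂, ⟨i₁⟩, ⟨i₂⟩ =>
    ⟨ModuleCat.of A PUnit.{u + 1}, ModuleCat.of A PUnit.{u + 1}, inferInstance, projective_punit,
      inferInstance, projective_punit,
      ⟨((i₁ ≪≫ i₂.symm).toLinearEquiv.prodCongr (LinearEquiv.refl A PUnit.{u + 1})).toModuleIso⟩⟩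
  | s + 1, K₁, K₂, ⟨K₁', P₁, h₁, hP₁, hproj₁, f₁, g₁, w₁, hS₁⟩,
      ⟨K₂', P₂, h₂, hP₂, hproj₂, f₂, g₂, w₂, hS₂⟩ => by
    obtain ⟨Q₁, Q₂, hQ₁, hQproj₁, hQ₂, hQproj₂, ⟨e⟩⟩ := IsSyzygy.exists_stablyIso h₁ h₂
    -- `K₁ = Ω(K₁' ⊕ Q₂)`, `K₂ = Ω(K₂' ⊕ Q₁) = Ω(K₁' ⊕ Q₂)`
    have hK₁ : IsSyzygy 1 (ModuleCat.of A (K₁' × Q₂)) K₁ :=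
      (isSyzygy_one_iff.mpr ⟨P₁, hP₁, hproj₁, f₁, g₁, w₁, hS₁⟩).prod_projective hQ₂ hQproj₂
    have hK₂ : IsSyzygy 1 (ModuleCat.of A (K₁' × Q₂)) K₂ :=
      ((isSyzygy_one_iff.mpr ⟨P₂, hP₂, hproj₂, f₂, g₂, w₂, hS₂⟩).prod_projective
        hQ₁ hQproj₁).of_iso_base e.symm
    exact hK₁.exists_stablyIso_one hK₂

/-! ## The horseshoe lemma -/

/-- **Horseshoe lemma**, first syzygies: for `0 → Y → Z → X → 0` exact and first syzygies
`K_Y` of `Y` (cover `P₁`) and `K_X` of `X` (cover `P₂`), the kernel `E` of the surjection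
`P₁ ⊕ P₂ ↠ Z` (built from a lift `P₂ → Z` of `P₂ ↠ X`) is a first syzygy of `Z` sitting in an
exact `0 → K_Y → E → K_X → 0`. [folklore] -/
theorem exists_isSyzygy_one_of_shortExact {Y Z X : ModuleCat.{u} A} {f : Y ⟶ Z} {g : Z ⟶ X}
    {w : f ≫ g = 0} (hS : (ShortComplex.mk f g w).ShortExact) {KY KX : ModuleCat.{u} A}
    (hY : IsSyzygy 1 Y KY) (hX : IsSyzygy 1 X KX) :
    ∃ E : ModuleCat.{u} A, IsSyzygy 1 Z E ∧ ∃ (f' : KY ⟶ E) (g' : E ⟶ KX) (w' : f' ≫ g' = 0),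
      (ShortComplex.mk f' g' w').ShortExact := by
  obtain ⟨hf, hg, hfg⟩ := shortExact_unpack hS
  obtain ⟨P₁, hP₁, hproj₁, ι₁, π₁, v₁, hT₁⟩ := isSyzygy_one_iff.mp hY
  obtain ⟨P₂, hP₂, hproj₂, ι₂, π₂, v₂, hT₂⟩ := isSyzygy_one_iff.mp hX
  obtain ⟨hι₁, hπ₁, hιπ₁⟩ := shortExact_unpack hT₁
  obtain ⟨hι₂, hπ₂, hιπ₂⟩ := shortExact_unpack hT₂
  haveI := hP₁
  haveI := hP₂
  haveI := moduleProjective_of_projective P₂ hproj₂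
  -- lift `π₂` through `g`
  obtain ⟨lam, hlam⟩ := Module.projective_lifting_property g.hom π₂.hom hg
  have hlam' : ∀ p, g.hom (lam p) = π₂.hom p := fun p => LinearMap.congr_fun hlam p
  -- the cover `piZ : P₁ ⊕ P₂ ↠ Z`
  let piZ : (P₁ × P₂) →ₗ[A] Z := (f.hom ∘ₗ π₁.hom).coprod lam
  have hpiZ : ∀ p : P₁ × P₂, piZ p = f.hom (π₁.hom p.1) + lam p.2 := fun p => rfl
  have hpiZsurj : Function.Surjective piZ := by
    intro z
    obtain ⟨p₂, hp₂⟩ := hπ₂ (g.hom z)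
    have hz : g.hom (z - lam p₂) = 0 := by rw [map_sub, hlam', hp₂, sub_self]
    obtain ⟨y, hy⟩ := (hfg _).1 hz
    obtain ⟨p₁, rfl⟩ := hπ₁ y
    exact ⟨(p₁, p₂), by rw [hpiZ]; exact eq_sub_iff_add_eq.mp hy⟩
  let E := LinearMap.ker piZ
  -- `E` is a first syzygy of `Z`
  obtain ⟨wE, hSE⟩ := exists_shortExact_of_linearMap (Y := ModuleCat.of A E)
    (M := ModuleCat.of A (P₁ × P₂)) (X := Z) E.subtype piZ Subtype.val_injective hpiZsurj
    (LinearMap.exact_subtype_ker_map piZ)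
  have hE : IsSyzygy 1 Z (ModuleCat.of A E) :=
    isSyzygy_one_iff.mpr ⟨ModuleCat.of A (P₁ × P₂), inferInstance, projective_prod hproj₁ hproj₂,
      _, _, wE, hSE⟩
  -- `0 → K_Y → E → K_X → 0`
  have hmem : ∀ x : E, x.1.2 ∈ LinearMap.range ι₂.hom := fun x => by
    refine LinearMap.mem_range.mpr ((hιπ₂ _).1 ?_)
    have hx : piZ x.1 = 0 := x.2
    have := congrArg g.hom hx
    rwa [hpiZ, map_add, map_zero, hlam', show g.hom (f.hom (π₁.hom x.1.1)) = 0 from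
      hfg.apply_apply_eq_zero _, zero_add] at this
  let α : KY →ₗ[A] E := LinearMap.codRestrict E (LinearMap.inl A P₁ P₂ ∘ₗ ι₁.hom) fun k => by
    show piZ (ι₁.hom k, 0) = 0
    rw [hpiZ, map_zero, add_zero, show π₁.hom (ι₁.hom k) = 0 from hιπ₁.apply_apply_eq_zero k,
      map_zero]
  let eR := LinearEquiv.ofInjective ι₂.hom hι₂
  let β : E →ₗ[A] KX := eR.symm.toLinearMap ∘ₗ
    LinearMap.codRestrict (LinearMap.range ι₂.hom) (LinearMap.snd A P₁ P₂ ∘ₗ E.subtype) hmem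
  have hβ : ∀ x : E, ι₂.hom (β x) = x.1.2 := fun x => by
    have h := congrArg Subtype.val (eR.apply_symm_apply ⟨x.1.2, hmem x⟩)
    rw [LinearEquiv.ofInjective_apply] at h
    exact h
  have hα_inj : Function.Injective α := by
    intro k₁ k₂ hk
    have := congrArg (fun x : E => x.1.1) hk
    exact hι₁ (by simpa [α] using this)
  have hβ_surj : Function.Surjective β := by
    intro k
    have h0 : g.hom (lam (ι₂.hom k)) = 0 := by
      rw [hlam']; exact hιπ₂.apply_apply_eq_zero k
    obtain ⟨y, hy⟩ := (hfg _).1 h0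
    obtain ⟨p₁, rfl⟩ := hπ₁ y
    have hx : ((-p₁, ι₂.hom k) : P₁ × P₂) ∈ E := by
      show piZ (-p₁, ι₂.hom k) = 0
      rw [hpiZ, map_neg, map_neg, ← hy, neg_add_cancel]
    exact ⟨⟨_, hx⟩, hι₂ (by rw [hβ])⟩
  have hαβ : Function.Exact α β := by
    intro x
    constructor
    · intro hx0
      have h2 : x.1.2 = 0 := by rw [← hβ, hx0, map_zero]
      have h1 : f.hom (π₁.hom x.1.1) = 0 := by
        have hx : piZ x.1 = 0 := x.2
        rwa [hpiZ, h2, map_zero, add_zero] at hx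
      obtain ⟨k, hk⟩ := (hιπ₁ _).1 (hf (by rw [h1, map_zero]))
      refine ⟨k, Subtype.ext (Prod.ext ?_ ?_)⟩
      · simpa [α] using hk
      · simp [α, h2]
    · rintro ⟨k, rfl⟩
      apply hι₂
      rw [hβ, map_zero]
      rfl
  obtain ⟨w', hS'⟩ := exists_shortExact_of_linearMap (Y := KY) (M := ModuleCat.of A E) (X := KX)
    α β hα_inj hβ_surj hαβ
  exact ⟨ModuleCat.of A E, hE, _, _, w', hS'⟩

/-- **Horseshoe lemma for `Ωˢ`**: for `0 → Y → Z → X → 0` exact and `s`-th syzygies `K_Y` of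
`Y`, `K_X` of `X`, some `s`-th syzygy `E` of `Z` sits in an exact `0 → K_Y → E → K_X → 0`.
[folklore] -/
theorem exists_isSyzygy_of_shortExact :
    ∀ {s : ℕ} {Y Z X : ModuleCat.{u} A} {f : Y ⟶ Z} {g : Z ⟶ X} {w : f ≫ g = 0},
      (ShortComplex.mk f g w).ShortExact → ∀ {KY KX : ModuleCat.{u} A},
        IsSyzygy s Y KY → IsSyzygy s X KX →
          ∃ E : ModuleCat.{u} A, IsSyzygy s Z E ∧ ∃ (f' : KY ⟶ E) (g' : E ⟶ KX)
            (w' : f' ≫ g' = 0), (ShortComplex.mk f' g' w').ShortExact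
  | 0, Y, Z, X, f, g, w, hS, KY, KX, ⟨iY⟩, ⟨iX⟩ => by
    obtain ⟨w₁, hS₁⟩ := shortExact_iso_comp hS iY.symm
    obtain ⟨w₂, hS₂⟩ := shortExact_comp_iso₃ hS₁ iX.symm
    exact ⟨Z, ⟨Iso.refl Z⟩, _, _, w₂, hS₂⟩
  | s + 1, Y, Z, X, f, g, w, hS, KY, KX, hY, hX => by
    obtain ⟨Y₁, hY₁, hY'⟩ := isSyzygy_succ_iff_exists_first.mp hY
    obtain ⟨X₁, hX₁, hX'⟩ := isSyzygy_succ_iff_exists_first.mp hX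
    obtain ⟨Z₁, hZ₁, f₁, g₁, w₁, hS₁⟩ := exists_isSyzygy_one_of_shortExact hS hY₁ hX₁
    obtain ⟨E, hE, f', g', w', hS'⟩ := exists_isSyzygy_of_shortExact hS₁ hY' hX'
    exact ⟨E, isSyzygy_succ_iff_exists_first.mpr ⟨Z₁, hZ₁, hE⟩, f', g', w', hS'⟩

/-! ## Syzygies of retracts; projectives in `add G` -/

/-- A module with a first syzygy is finitely generated (it is a quotient of the finitely
generated cover). [folklore] -/
theorem finite_of_isSyzygy_one {M K : ModuleCat.{u} A} (h : IsSyzygy 1 M K) : Module.Finite A M := by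
  obtain ⟨P, hP, -, f, g, w, hS⟩ := isSyzygy_one_iff.mp h
  haveI := hP
  exact Module.Finite.of_surjective g.hom hS.moduleCat_surjective_g

/-- Every finitely generated module has a first syzygy (with a finite free cover). [folklore] -/
theorem exists_isSyzygy_one (M : ModuleCat.{u} A) [Module.Finite A M] :
    ∃ K : ModuleCat.{u} A, IsSyzygy 1 M K := by
  obtain ⟨n, π, hπ⟩ := Module.Finite.exists_fin' A M
  obtain ⟨w, hS⟩ := exists_shortExact_of_linearMap (Y := ModuleCat.of A (LinearMap.ker π))
    (M := ModuleCat.of A (Fin n → A)) (X := M) (LinearMap.ker π).subtype π Subtype.val_injective hπ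
    (LinearMap.exact_subtype_ker_map π)
  refine ⟨ModuleCat.of A (LinearMap.ker π), isSyzygy_one_iff.mpr ⟨ModuleCat.of A (Fin n → A),
    inferInstance, ?_, _, _, w, hS⟩⟩
  exact (IsProjective.iff_projective (R := A) (Fin n → A)).mp inferInstance

/-- **Syzygies of a retract**: if `X` is a retract of `Z` (`i ≫ p = 𝟙 X`), `K_Z` is a first
syzygy of `Z` and `K_X` one of `X`, then `K_X` is a retract of `K_Z ⊕ Q` for some finitely
generated projective `Q` (`Z ≅ X ⊕ X'`; `K_X ⊕ Ω X'` is a first syzygy of `Z`; Schanuel).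
[folklore] -/
theorem exists_retract_isSyzygy_of_retract {X Z KX KZ : ModuleCat.{u} A} (i : X ⟶ Z) (p : Z ⟶ X)
    (hip : i ≫ p = 𝟙 X) (hZ : IsSyzygy 1 Z KZ) (hX : IsSyzygy 1 X KX) :
    ∃ Q : ModuleCat.{u} A, Module.Finite A Q ∧ Projective Q ∧
      ∃ (i' : KX ⟶ ModuleCat.of A (KZ × Q)) (p' : ModuleCat.of A (KZ × Q) ⟶ KX), i' ≫ p' = 𝟙 KX := by
  haveI := finite_of_isSyzygy_one hZ
  obtain ⟨e⟩ := exists_iso_prod_of_retract i p hip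
  -- the complement `X' = Ker p` is finitely generated; choose a first syzygy of it
  haveI : Module.Finite A (LinearMap.ker p.hom) := by
    refine Module.Finite.of_surjective ((LinearMap.snd A X _) ∘ₗ e.hom.hom) ?_
    exact Prod.snd_surjective.comp e.toLinearEquiv.surjective
  obtain ⟨K', hK'⟩ := exists_isSyzygy_one (ModuleCat.of A (LinearMap.ker p.hom))
  -- `K_X ⊕ K'` is a first syzygy of `X ⊕ X' ≅ Z`
  have h2 : IsSyzygy 1 Z (ModuleCat.of A (KX × K')) := (hX.prod hK').of_iso_base e.symm
  obtain ⟨P₁, P₂, hP₁, hproj₁, -, -, ⟨ε⟩⟩ := h2.exists_stablyIso_one hZ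
  -- `K_X ↪ (K_X ⊕ K') ⊕ P₂ ≅ K_Z ⊕ P₁`
  refine ⟨P₁, hP₁, hproj₁,
    ModuleCat.ofHom ((LinearMap.inl A _ P₂) ∘ₗ LinearMap.inl A KX K') ≫ ε.hom,
    ε.inv ≫ ModuleCat.ofHom (LinearMap.fst A KX K' ∘ₗ LinearMap.fst A _ P₂), ?_⟩
  rw [Category.assoc, ε.hom_inv_id_assoc]
  apply ModuleCat.hom_ext
  exact LinearMap.ext fun x => rfl

end Literature.RingTheory.CohomologyAnnihilator

end
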